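import Literature.MathematicalPhysics.QuantumFieldTheory.Balaban1983to89.B14DomainGeom
import Literature.MathematicalPhysics.QuantumFieldTheory.Balaban1983to89.B15DeterminingSets

/-!
# `Balaban1983to89.B14Def2p256` — CMP 119 §2 p. 256: the standing assumptions on the DOMAIN CLASSES (`Ω_j, Λ_j` unions
# of `MR_j`-cubes, boundary distances `≥ 2MR_j`) and on the LARGE-FIELD VARIABLES (`V_{j−1}` on the bonds of
# `Ω_j^{(j−1)c}`, regular on `Γ_{j−1}`: `|∂V_{j−1} − 1| < O(L²)ε_{j−1}`), as predicates WITH BODY; the sentence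
# *"Obviously Γ_{j−1} ⊂ Ω_j^{(j−1)c}"* PROVED on r12's determining-set carrier

statement-level skeleton of published theorems with citation tags; proofs where landed; nothing here is a claim about the Yang–Mills mass gap

CITATION HEADER (lean-in-tree rule).  Source: T. Bałaban, *Convergent renormalization expansions for lattice gauge
theories*, Commun. Math. Phys. **119**, 243–285 (1988), doi:10.1007/bf01217741 [Balaban1988Convergent] (cell paper
B14 = «[III]»; held `paper:balaban1988-cmp119-convergent-renormalization`, journal page = PDF page + 242; p. 256 read on
the text layer `p0014` and the x2 render `…-p014-x2.png`).  Mega-formalization `lit-balaban`, unit `lit-balaban-r11`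
(CMP 119, B14 fold owner), SKELETON row **B14.Def§2.p256** (neighbours: B14.Eq2.1 = (2.1)–(2.3) admissibility,
B14.Eq2.2 = the determining set `{Γ_j}`, B14.Eq2.4 = `ε_j`).

THE PRINTED TEXT (p. 256 [PDF 14], verbatim).  *"The domains Ω_j, Λ_j, which are determined by the j-th renormalization
transformation, but not by the R-operation, are unions of MR_j-cubes in the lattice T_{L^{−j}}. They satisfy also
other conditions, e.g., the distance between their boundaries is at least equal to 2MR_j, which will be determined
inductively by the operations in the k+1-st step. In the first step the integration with respect to the variables
U↾_{Ω₁ᶜ} = V₀ was left unchanged. Similarly in the next steps there are integrations with respect to variables on large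
field regions left. In j-th step the region is Ω_j, and gauge field variables V_{j−1} are defined on bonds of
Ω_j^{(j−1)c}. Obviously Γ_{j−1} ⊂ Ω_j^{(j−1)c}, and we assume that the field V_{j−1} is regular on Γ_{j−1} in the sense
that |∂V_{j−1} − 1| < O(L²)ε_{j−1}."*

THE CARRIERS (pre-existing, BY NAME).  Domains: pv02's cube carrier `B14DomainGeom.{Pt, IsUnionOfCubes, enl}` (sites of
the fine lattice, cubes of side `s` in its units; `enl s n` = `n` layers of side-`s` cubes added) — the side of the
`MR_j`-cubes enters as the PARAMETER `sZ j`, the set of 𝐑-produced indices as the PARAMETER `Rprod` (READING RULE (a):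
printed objects as parameters).  Fields: `Setup.{GaugeField, Plaq, PlaqSmallOn, epsK, Flow}` (`PlaqSmallOn S δ V` =
`∀ p ∈ S, |V(∂p) − 1| < δ`, `epsK A₀ p₀ F j = ε_j` (2.4)); the regions `Γ_{j−1}` of (2.2) are r12's
`B15DeterminingSets.gammaRegion Ω k (j−1)` (row B14.Eq2.2, `proved`), their plaquettes at scale `j−1` a parameter `Γp`.

WHAT IS TYPED / PROVED (0 `sorry`; `Prop`-valued predicates on the data, no named fact).
§1  `DomClass Rprod sZ k Ω Λ` — *"Ω_j, Λ_j … not [determined] by the R-operation, are unions of MR_j-cubes"*;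
    `BdDist Rprod sZ k Ω Λ` — the printed EXAMPLE condition *"the distance between their boundaries is at least equal to
    2MR_j"* as `(Λ_j)^{∼2} ⊆ Ω_j` (two layers of `MR_j`-cubes around `Λ_j` inside `Ω_j`) for the non-𝐑 indices;
    consequences `DomClass.cubesZ` (`Z_j = Λ_jᶜ` is a union of cubes), `BdDist.subset` (`Λ_j ⊆ Ω_j`), `of_all_R`
    (vacuous when every index is 𝐑-produced), `domClass_univ` (non-vacuity).
§2  `FieldRegular C A₀ p₀ F Γp V k` — *"V_{j−1} is regular on Γ_{j−1} in the sense that |∂V_{j−1} − 1| < O(L²)ε_{j−1}"*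
    for `j = 1, …, k`, the `O(L²)` as `C·L²` with the `O(1)` constant `C` a parameter; `FieldRegular.mono` (a larger
    `C` is weaker), `FieldRegular.mono_k`, `fieldRegular_zero`; and the sentence **`gammaRegion_pred_subset_compl`**:
    *"Obviously Γ_{j−1} ⊂ Ω_j^{(j−1)c}"* — `gammaRegion Ω k (j−1) ⊆ (Ω j)ᶜ` for `1 ≤ j ≤ k`, PROVED from (2.2)
    (`Γ₀ = Ω₁ᶜ`, `Γ_i = Ω_i ∖ Ω_{i+1}`).

NOT ASSERTED: which indices are 𝐑-produced or what the 𝐑-operation does to the domains ([B15]/[B16]); the full list of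
*"other conditions"* (only print's example is typed); the value of the `O(1)` constant.

## References
* [Balaban1988Convergent] T. Bałaban, Commun. Math. Phys. 119 (1988) 243–285, §2 p. 256 (and (2.2) p. 255, (2.4) p. 255).
-/

namespace Literature.MathematicalPhysics.QuantumFieldTheory.Balaban1983to89.B14.Def2p256

open Literature.MathematicalPhysics.QuantumFieldTheory.Balaban1983to89

/-! ## §1. The domain classes (cube carrier) -/
section Domains

open B14DomainGeom

variable {d : ℕ}

/-- **p. 256, the cube classes**: *"The domains Ω_j, Λ_j, which are determined by the j-th renormalization transformation,
but not by the R-operation, are unions of MR_j-cubes in the lattice T_{L^{−j}}"* — for the indices `1 ≤ j ≤ k` outside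
the set `Rprod` of 𝐑-produced ones, `Ω_j` and `Λ_j` are unions of cubes of side `sZ j` (= `MR_j` in carrier units).
[cite: Balaban1988Convergent, §2 p.256] -/
structure DomClass (Rprod : Set ℕ) (sZ : ℕ → ℕ) (k : ℕ) (Ω Λ : ℕ → Set (Pt d)) : Prop where
  cubesΩ : ∀ j, 1 ≤ j → j ≤ k → j ∉ Rprod → IsUnionOfCubes (sZ j) (Ω j)
  cubesΛ : ∀ j, 1 ≤ j → j ≤ k → j ∉ Rprod → IsUnionOfCubes (sZ j) (Λ j)

/-- **p. 256, the printed EXAMPLE of the further conditions**: *"e.g., the distance between their boundaries is at least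
equal to 2MR_j"* — two layers of `MR_j`-cubes around `Λ_j` still lie in `Ω_j`: `(Λ_j)^{∼2} ⊆ Ω_j` (non-𝐑 indices).
[cite: Balaban1988Convergent, §2 p.256] -/
structure BdDist (Rprod : Set ℕ) (sZ : ℕ → ℕ) (k : ℕ) (Ω Λ : ℕ → Set (Pt d)) : Prop where
  bdist : ∀ j, 1 ≤ j → j ≤ k → j ∉ Rprod → enl (sZ j) 2 (Λ j) ⊆ Ω j

namespace DomClass

variable {Rprod : Set ℕ} {sZ : ℕ → ℕ} {k : ℕ} {Ω Λ : ℕ → Set (Pt d)}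

/-- The large field regions `Z_j = Λ_jᶜ` of the non-𝐑 indices are unions of `MR_j`-cubes too. [cite: Balaban1988Convergent, (2.3) p.255, §2 p.256] -/
theorem cubesZ (h : DomClass Rprod sZ k Ω Λ) {j : ℕ} (h1 : 1 ≤ j) (hj : j ≤ k) (hR : j ∉ Rprod) :
    IsUnionOfCubes (sZ j) (Λ j)ᶜ :=
  (h.cubesΛ j h1 hj hR).compl

/-- Restriction to a smaller top index. [cite: Balaban1988Convergent, §2 p.256] -/
theorem mono_k (h : DomClass Rprod sZ k Ω Λ) {k' : ℕ} (hk : k' ≤ k) : DomClass Rprod sZ k' Ω Λ where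
  cubesΩ j h1 hj := h.cubesΩ j h1 (hj.trans hk)
  cubesΛ j h1 hj := h.cubesΛ j h1 (hj.trans hk)

/-- If every index is 𝐑-produced the class condition is vacuous (print states it only for the other indices).
[cite: Balaban1988Convergent, §2 p.256] -/
theorem of_all_R (sZ : ℕ → ℕ) (k : ℕ) (Ω Λ : ℕ → Set (Pt d)) : DomClass (Set.univ : Set ℕ) sZ k Ω Λ where
  cubesΩ _ _ _ h := absurd (Set.mem_univ _) h
  cubesΛ _ _ _ h := absurd (Set.mem_univ _) h

end DomClass

namespace BdDist

variable {Rprod : Set ℕ} {sZ : ℕ → ℕ} {k : ℕ} {Ω Λ : ℕ → Set (Pt d)}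

/-- The boundary-distance condition implies the inclusion `Λ_j ⊆ Ω_j` of (2.1). [cite: Balaban1988Convergent, (2.1) p.254, §2 p.256] -/
theorem subset (h : BdDist Rprod sZ k Ω Λ) {j : ℕ} (h1 : 1 ≤ j) (hj : j ≤ k) (hR : j ∉ Rprod) : Λ j ⊆ Ω j :=
  (subset_enl (sZ j) 2 (Λ j)).trans (h.bdist j h1 hj hR)

/-- … and even one layer: `(Λ_j)^{∼} ⊆ Ω_j`. [cite: Balaban1988Convergent, §2 p.256] -/
theorem enl_one_subset (h : BdDist Rprod sZ k Ω Λ) {j : ℕ} (h1 : 1 ≤ j) (hj : j ≤ k) (hR : j ∉ Rprod) :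
    enl (sZ j) 1 (Λ j) ⊆ Ω j :=
  (enl_mono_layers (sZ j) (by norm_num : 1 ≤ 2) (Λ j)).trans (h.bdist j h1 hj hR)

end BdDist

/-- Non-vacuity: the whole lattice at every scale (no large fields) is in the class and satisfies the boundary-distance
example. [cite: Balaban1988Convergent, §2 p.256] -/
theorem domClass_univ (Rprod : Set ℕ) (sZ : ℕ → ℕ) (k : ℕ) :
    DomClass Rprod sZ k (fun _ => (Set.univ : Set (Pt d))) (fun _ => Set.univ) ∧
      BdDist Rprod sZ k (fun _ => (Set.univ : Set (Pt d))) (fun _ => Set.univ) :=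
  ⟨⟨fun _ _ _ _ => fun _ _ _ => Iff.rfl, fun _ _ _ _ => fun _ _ _ => Iff.rfl⟩, ⟨fun _ _ _ _ => Set.subset_univ _⟩⟩

end Domains

/-! ## §2. The large-field variables (torus carrier) -/
section Fields

open B15DeterminingSets

variable {P : Params} {G : Type*} [GaugeGroup G]

/-- **p. 256, regularity of the left-over large-field variables**: *"we assume that the field V_{j−1} is regular on
Γ_{j−1} in the sense that |∂V_{j−1} − 1| < O(L²)ε_{j−1}"*, `j = 1, …, k` — `Setup.PlaqSmallOn` on the plaquettes `Γp i`
of `Γ_i` at scale `i` with threshold `C·L²·ε_i`, `ε_i = Setup.epsK A₀ p₀ F i` (2.4), the `O(1)` constant `C` a parameter.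
[cite: Balaban1988Convergent, §2 p.256] -/
def FieldRegular (C A₀ : ℝ) (p₀ : ℕ) (F : Flow) (Γp : (i : ℕ) → Set (Plaq P i)) (V : (i : ℕ) → GaugeField P i G)
    (k : ℕ) : Prop :=
  ∀ j, 1 ≤ j → j ≤ k → PlaqSmallOn (Γp (j - 1)) (C * (P.L : ℝ) ^ 2 * epsK A₀ p₀ F (j - 1)) (V (j - 1))

namespace FieldRegular

variable {C C' A₀ : ℝ} {p₀ : ℕ} {F : Flow} {Γp : (i : ℕ) → Set (Plaq P i)} {V : (i : ℕ) → GaugeField P i G} {k : ℕ}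

/-- Unfolding at one index. [cite: Balaban1988Convergent, §2 p.256] -/
theorem apply (h : FieldRegular C A₀ p₀ F Γp V k) {j : ℕ} (h1 : 1 ≤ j) (hj : j ≤ k) :
    PlaqSmallOn (Γp (j - 1)) (C * (P.L : ℝ) ^ 2 * epsK A₀ p₀ F (j - 1)) (V (j - 1)) :=
  h j h1 hj

/-- A larger `O(1)` constant is a weaker requirement (when `L²ε_{j−1} ≥ 0`). [cite: Balaban1988Convergent, §2 p.256] -/
theorem mono (h : FieldRegular C A₀ p₀ F Γp V k) (hC : C ≤ C') (hε : ∀ i, i < k → 0 ≤ epsK A₀ p₀ F i) :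
    FieldRegular C' A₀ p₀ F Γp V k := by
  intro j h1 hj p hp
  have hlt := h j h1 hj p hp
  have hmono : C * (P.L : ℝ) ^ 2 * epsK A₀ p₀ F (j - 1) ≤ C' * (P.L : ℝ) ^ 2 * epsK A₀ p₀ F (j - 1) :=
    mul_le_mul_of_nonneg_right (mul_le_mul_of_nonneg_right hC (by positivity)) (hε (j - 1) (by omega))
  exact lt_of_lt_of_le hlt hmono

/-- Restriction to a smaller top index. [cite: Balaban1988Convergent, §2 p.256] -/
theorem mono_k (h : FieldRegular C A₀ p₀ F Γp V k) {k' : ℕ} (hk : k' ≤ k) : FieldRegular C A₀ p₀ F Γp V k' :=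
  fun j h1 hj => h j h1 (hj.trans hk)

end FieldRegular

/-- At `k = 0` nothing is required. [cite: Balaban1988Convergent, §2 p.256] -/
theorem fieldRegular_zero (C A₀ : ℝ) (p₀ : ℕ) (F : Flow) (Γp : (i : ℕ) → Set (Plaq P i))
    (V : (i : ℕ) → GaugeField P i G) : FieldRegular C A₀ p₀ F Γp V 0 :=
  fun j h1 hj => absurd hj (by omega)

/-- **p. 256: *"Obviously Γ_{j−1} ⊂ Ω_j^{(j−1)c}"*** — on r12's determining-set carrier (row B14.Eq2.2: `Γ₀ = Ω₁ᶜ`,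
`Γ_i = Ω_i ∖ Ω_{i+1}` for `0 < i < k`): `Γ_{j−1} ⊆ (Ω_j)ᶜ` for `1 ≤ j ≤ k`. [cite: Balaban1988Convergent, §2 p.256, (2.2) p.255] -/
theorem gammaRegion_pred_subset_compl (Ω : ℕ → Set (Site P 0)) {k j : ℕ} (h1 : 1 ≤ j) (hj : j ≤ k) :
    gammaRegion Ω k (j - 1) ⊆ (Ω j)ᶜ := by
  rcases Nat.lt_or_ge 1 j with hlt | hle
  · rw [gammaRegion_mid Ω (by omega) (by omega), show j - 1 + 1 = j by omega]
    exact fun x hx => hx.2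
  · have hj1 : j = 1 := le_antisymm hle h1
    subst hj1
    rw [show (1 : ℕ) - 1 = 0 from rfl, gammaRegion_zero Ω (by omega)]

end Fields

end Literature.MathematicalPhysics.QuantumFieldTheory.Balaban1983to89.B14.Def2p256
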